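import Literature.Topology.FourManifolds.SPC4Wave0
import Literature.Topology.FourManifolds.MorseReebSphereProofs
import Literature.Topology.FourManifolds.ExoticSevenSphereSignature
import HarnessLib

/-!
# Milnor's exotic `7`-sphere: the Morse-theoretic half of Milnor's proof (reductions)

Topic `Literature/Topology/FourManifolds` (fact seat
`provefact-Literature.Topology.FourManifolds.exists_homeomorph_isEmpty_diffeomorph_sphere_seven`).
The target is the tree's named fact
`Literature.Topology.FourManifolds.exists_homeomorph_isEmpty_diffeomorph_sphere_seven`
(`SPC4Wave0.lean`, **spc4.S12**, Mathlib's `proof_wanted` of the same name): *there is a smooth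
`7`-manifold homeomorphic but not diffeomorphic to `S⁷`* — J. Milnor, *On manifolds homeomorphic
to the `7`-sphere*, Ann. of Math. 64 (1956), 399–405, **Theorem 3** (p. 403): "For `k² ≢ 1 mod 7`
the manifold `M⁷ₖ` is homeomorphic to `S⁷` but not diffeomorphic to `S⁷`."  Everything in this
file is **proved**; no definitions, no new named facts (D-0026): the deep input appears as an
explicit hypothesis which is a printed intermediate statement of Milnor's paper, or a tree
named fact.

## Milnor's proof and what the tree has

Milnor's proof has two halves.

* **Homeomorphic to `S⁷`.** §2, hypothesis (H): "there exists a differentiable function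
  `f : Mⁿ → ℝ` having only two critical points `x₀, x₁`. Furthermore these critical points are
  non-degenerate", and **Theorem 2** (p. 401, "essentially due to Reeb"): (H) implies that `Mⁿ`
  is homeomorphic to `Sⁿ`; **Lemma 5** (§3): `M⁷ₖ` satisfies (H). In the tree (H) reads
  `∃ f, IsMorse (𝓡 n) f ∧ (criticalSet (𝓡 n) f).ncard = 2` (`Morse.lean`) and Theorem 2 is the
  named fact `nonempty_homeomorph_sphere_of_ncard_criticalSet_eq_two`, DISCHARGED in every
  dimension (`nonempty_homeomorph_sphere_of_ncard_criticalSet_eq_two_holds`,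
  `MorseReebSphereProofs.lean`: Morse lemma, gradient flow, twisted sphere, Alexander trick).
* **Not diffeomorphic to `S⁷`.** §1, **Theorem 1**: the residue `λ(M⁷) = 2q(B⁸) - τ(B⁸) mod 7`
  (`B⁸` a cobounding manifold, `τ` its signature, `q = ⟨p₁², [B, ∂B]⟩` its Pontryagin number) is
  an invariant of the closed oriented `7`-manifold `M⁷` with `H³ = H⁴ = 0`, by Thom's cobordism
  theorem and Hirzebruch's signature theorem `τ(C⁸) = (7p₂ - p₁²)/45`; **Lemma 3**
  (`p₁(ξₕⱼ) = ±2(h-j)ι`, via `p₁(ℍP²)`), **Lemma 4** (`λ(M⁷ₖ) ≡ k² - 1 mod 7`), whence `M⁷ₖ ≇ S⁷`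
  for `k² ≢ 1 mod 7` since `λ(S⁷) = 0`. Pontryagin classes and the signature theorem are absent
  from Mathlib and from the tree; the tree's substitute for `λ` is the signature `σ mod 224` of
  s-parallelizable cobounding `8`-manifolds (`ExoticSevenSphereSignature.lean`, see below).

## What this file adds (half (A), Milnor's §2), and the sibling files

* `exists_homeomorph_isEmpty_diffeomorph_sphere_seven_of_isMorse` — **Milnor's own line**: from a
  closed smooth `7`-manifold satisfying (H) which is not diffeomorphic to `S⁷` (the printed
  content of Lemma 5 with Lemma 4/Theorem 1 for `M⁷₃`), by the discharged Theorem 2.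
* `exists_homeomorph_isEmpty_diffeomorph_sphere_seven_of_isTwistedSphere` — the same through
  §2, Construction (C) / Cor. 3 (a manifold satisfies (H) iff it is two cells matched along the
  boundary) and §4, Thm. 5: from a twisted sphere `𝔻⁷ ∪_φ 𝔻⁷` not diffeomorphic to `S⁷`, by the
  Alexander trick (`IsTwistedSphere.nonempty_homeomorph_sphere`, `MorseReebSphereProofs.lean`).
* `exists_homeomorph_isEmpty_diffeomorph_sphere_seven_of_natCard_of_propB` — a one-line
  composition recording that the two tree facts `natCard_homotopySphereClass_seven`
  (`|Θ₇| = 28`, `HCobordism.lean`) and `nonempty_homeomorph_sphere_of_homologySphere_of_five_le`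
  (Milnor 1965, §9, Prop. B, `SmaleHomologySpheres.lean`) imply the target, through the sibling
  theorem `exists_homeomorph_isEmpty_diffeomorph_sphere_seven_of_nontrivial_of_propB`.

The other half — an exotic sphere from invariants of the smooth structure — is run in the sibling
pure-proof files (landed independently, not restated here):

* `ExoticSevenSphere.lean`: the target from a nontrivial `Θ₇ = HomotopySphereClass 7`
  (`…_of_nontrivial`) or from `|Θ₇| = 28` (`…_of`), with the homeomorphism to `S⁷` taken from the
  generalised topological Poincaré conjecture `nonempty_homeomorph_sphere_of_five_le`
  (`SPC4Wave0.lean`); and spc4.S32⁻ (`not_forall_nonemptyDiffeomorphSphere_seven_of`).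
* `ExoticSevenSphereSignature.lean`: the same with Milnor's Prop. B (h-cobordism route) in place
  of the topological Poincaré conjecture (`…_of_nontrivial_of_propB`), and — closest to Milnor's
  §1/§3 — the target from the signature leaves (`…_of_signature_leaves`, `…_of_e8_leaves`:
  `E₈`-plumbing of signature `8`, `224 ∣ σ` for the standard sphere by the signature theorem,
  Bredon VI.7.15, Prop. B) or through Kervaire–Milnor's Thm. 7.5 (`…_of_thm75`).
* `ExoticSevenSphereTheta.lean`: `Θ₇ ≠ 0` ⟺ spc4.S32⁻ ⟺ spc4.S12 (granted the Poincaré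
  hypotheses).

## References

* J. Milnor, *On manifolds homeomorphic to the 7-sphere*, Ann. of Math. 64 (1956), 399–405:
  §1 Thm. 1; §2 (H), Thm. 2 (p. 401), Construction (C), Cor. 3; §3 Lemmas 3–5, Thm. 3 (p. 403);
  §4 Thm. 5. [Milnor1956]
* M. Kervaire, J. Milnor, *Groups of homotopy spheres I*, Ann. of Math. 77 (1963), Thm. 1.2,
  table p. 504, §2 p. 507. [KervaireMilnorAnnals1963]
* J. Milnor, *Lectures on the h-cobordism theorem* (1965), §9, Prop. B and Corollary (p. 109),
  Remark p. 110 ("There exist smooth 7-manifolds `M⁷` that are homeomorphic to `S⁷` but are not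
  diffeomorphic to `S⁷`"). [MilnorHCobordism1965]
* G. Reeb (1952); J. Milnor, *Morse theory* (1963), Thm. 4.1. [Reeb1952] [Milnor1963]
-/

open scoped Manifold ContDiff Topology

noncomputable section

namespace Literature.Topology.FourManifolds

/-- Local notation: `𝔼 n` is the model Euclidean space `EuclideanSpace ℝ (Fin n)`. -/
local notation "𝔼 " n:arg => EuclideanSpace ℝ (Fin n)

/-- Local notation: `𝕊 n` is the unit sphere in `EuclideanSpace ℝ (Fin (n + 1))`. -/
local notation "𝕊 " n:arg => (Metric.sphere (0 : EuclideanSpace ℝ (Fin (n + 1))) 1)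

/-! ### Milnor's line: Theorem 2 (Reeb) reduces Theorem 3 to Lemma 5 and the `λ`-computation -/

/-- **Milnor 1956, Theorem 3 from Theorem 2 and (Lemma 5 + Lemma 4).** If there is a closed
smooth `7`-manifold `M` (compact, Hausdorff, second countable, modelled on `ℝ⁷`) satisfying
Milnor's hypothesis **(H)** — a smooth function with exactly two critical points, both
non-degenerate, i.e. a Morse function `f` with `(criticalSet (𝓡 7) f).ncard = 2` — which is not
diffeomorphic to `S⁷` (Milnor: `M = M⁷₃`, by Lemma 5 and Lemma 4 with Theorem 1), then there is a
smooth `7`-manifold homeomorphic but not diffeomorphic to `S⁷`: by **Theorem 2** (Reeb), (H)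
implies `M ≃ₜ S⁷` — the tree's discharged fact
`nonempty_homeomorph_sphere_of_ncard_criticalSet_eq_two_holds`. [cite: Milnor1956, §2 Thm. 2 (p. 401) and §3 Thm. 3 (p. 403), with Lemma 5] -/
theorem exists_homeomorph_isEmpty_diffeomorph_sphere_seven_of_isMorse
    (h : ∃ (M : Type) (_ : TopologicalSpace M) (_ : T2Space M) (_ : SecondCountableTopology M)
      (_ : CompactSpace M) (_ : ChartedSpace (𝔼 7) M) (_ : IsManifold (𝓡 7) ∞ M) (f : M → ℝ),
      IsMorse (𝓡 7) f ∧ (criticalSet (𝓡 7) f).ncard = 2 ∧ IsEmpty (M ≃ₘ⟮𝓡 7, 𝓡 7⟯ (𝕊 7))) :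
    exists_homeomorph_isEmpty_diffeomorph_sphere_seven := by
  obtain ⟨M, _, _, _, _, _, _, f, hf, h2, hM⟩ := h
  obtain ⟨e⟩ := nonempty_homeomorph_sphere_of_ncard_criticalSet_eq_two_holds 7 M f hf h2
  exact ⟨M, inferInstance, inferInstance, inferInstance, e, hM⟩

/-- **Milnor 1956, Theorem 3 through twisted spheres** (§2, Construction (C) and Cor. 3: a
manifold satisfies (H) iff it is obtained by matching two cells along their boundary; §4,
Thm. 5). If some twisted sphere `Σ(φ) = 𝔻⁷ ∪_φ 𝔻⁷` (`Literature.Topology.FourManifolds.TwistedSphere`,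
`φ` a diffeomorphism of `𝕊⁶`) is not diffeomorphic to `S⁷` (Milnor: `M⁷₃ = M⁷(f)` for a
diffeomorphism `f` of `S⁶` not smoothly isotopic to the identity), then there is a smooth
`7`-manifold homeomorphic but not diffeomorphic to `S⁷`: a twisted sphere "is clearly
homeomorphic to `Sⁿ`" (Alexander trick, tree theorem `IsTwistedSphere.nonempty_homeomorph_sphere`).
[cite: Milnor1956, §2 Construction (C), Cor. 3; §4 Thm. 5] -/
theorem exists_homeomorph_isEmpty_diffeomorph_sphere_seven_of_isTwistedSphere
    (h : ∃ (φ : (𝕊 6) ≃ₘ⟮𝓡 6, 𝓡 6⟯ (𝕊 6)) (T : TwistedSphere 6 φ),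
      IsEmpty (T.carrier ≃ₘ⟮𝓡 7, 𝓡 7⟯ (𝕊 7))) :
    exists_homeomorph_isEmpty_diffeomorph_sphere_seven := by
  obtain ⟨φ, T, hT⟩ := h
  obtain ⟨e⟩ := T.isTwistedSphere.nonempty_homeomorph_sphere
  exact ⟨T.carrier, inferInstance, inferInstance, inferInstance, e, hT⟩

/-! ### Record: `|Θ₇| = 28` and Prop. B imply the target -/

/-- **Milnor's exotic `7`-sphere from `|Θ₇| = 28` and Prop. B** (Kervaire–Milnor, *Groups of
homotopy spheres I* (1963), Thm. 1.2 and table p. 504; Milnor 1965, §9, Prop. B; Milnor 1956,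
Thm. 3): the tree facts `natCard_homotopySphereClass_seven` (`Nat.card (HomotopySphereClass 7) = 28`,
`HCobordism.lean`) and `nonempty_homeomorph_sphere_of_homologySphere_of_five_le`
(`SmaleHomologySpheres.lean`) imply `exists_homeomorph_isEmpty_diffeomorph_sphere_seven`: `28 > 1`
classes make `Θ₇` nontrivial (`nontrivial_homotopySphereClass_seven_of`, `HomotopySpheresBPOrder.lean`),
and `exists_homeomorph_isEmpty_diffeomorph_sphere_seven_of_nontrivial_of_propB`
(`ExoticSevenSphereSignature.lean`) applies. (With the topological Poincaré conjecture
`nonempty_homeomorph_sphere_of_five_le` in place of Prop. B this is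
`exists_homeomorph_isEmpty_diffeomorph_sphere_seven_of`, `ExoticSevenSphere.lean`.)
[cite: KervaireMilnorAnnals1963, Thm. 1.2 and table p. 504] -/
theorem exists_homeomorph_isEmpty_diffeomorph_sphere_seven_of_natCard_of_propB
    (h28 : natCard_homotopySphereClass_seven)
    (hPB : nonempty_homeomorph_sphere_of_homologySphere_of_five_le.{0}) :
    exists_homeomorph_isEmpty_diffeomorph_sphere_seven :=
  exists_homeomorph_isEmpty_diffeomorph_sphere_seven_of_nontrivial_of_propB
    (nontrivial_homotopySphereClass_seven_of h28) hPB

end Literature.Topology.FourManifolds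

end
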